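import Summits.CriticalPhenomena.PercolationContinuityZ3.Theorems.FK.Transplant.FreeBoundaryHypotheses
import Summits.CriticalPhenomena.PercolationContinuityZ3.Theorems.FK.Transplant.KNFreePinningEmbedding
import Summits.CriticalPhenomena.PercolationContinuityZ3.Theorems.FK.InfiniteVolumeBoxLaws
import Summits.CriticalPhenomena.PercolationContinuityZ3.Theorems.FK.BoxLimitComparison
import HarnessLib

/-!
# FK-continuity transplant, FT-05a (support part): the transplant's law `fkLaw` — probability, the pull-back to the
# finite piece, monotonicity in the weighting, Λ-INDEPENDENCE, and "weight-one pairs are open almost surely"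

Cell `fk-continuity` (bschramm), FRONTIER TRANSPLANT sub-cell, registry row FT-05a (the `fkLaw` API: this file and
`KNFreeLawTranslate.lean`, writer fkt-p3; the pinning-law INSTANCE `isPinningLaw_fkLaw` is FT-06d, writer fkt-p4,
INBOX 01:27Z); support file (`--supports stmt-CriticalPhenomena-4575`); builds on p205010 (kernel theorem, internal
audit signed; external expert review pending). HONEST FRAMING: the transplant `ufsc0_of_freeBoundaryHypothesis_r0`
this file serves is CONDITIONAL on the free-boundary penetration hypothesis FH (open at the same `p` for `q > 1`;
⇔ GRC Conj. (5.103) via the referee's calibration K1; barrier note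
`Literature.Barriers.CriticalPhenomena.SamePFreeBoundaryCriteria`, theorem `samePFreeBoundaryCriteria`, p243859);
it is a typed reduction, not a proof of FK continuity. THIS file is unconditional finite-volume measure theory: no
named facts, no sorries, standard axioms; nothing here is specific to `q = 2` or to `d = 3`.

## What is here

`fkLaw Λ W q` (FT-01 `FreeBoundaryHypotheses.lean`, p243857) is the edge-parameter random-cluster measure
`rcMeasureW` of the finite piece `Λ ⊆ ℤ^d` with the weighting `W` read on the pairs of `Λ`, no wired set, pushed
forward to bond configurations of `ℤ^d` by `liftEdges Λ`. We prove:

* `isProbabilityMeasure_fkLaw` (`0 < q`); `fkLaw_apply` / `fkLaw_real_apply` — `fkLaw Λ W q (A) = φ_{W∘Λ,q}(liftEdges⁻¹ A)`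
  (measurability / monotonicity of `liftEdges`: tree `measurable_liftEdges` (06b `InfiniteVolumeBoxLaws`),
  `isUpperSet_preimage_liftEdges` (fkp-10a `BoxLimitComparison`), imported);
* `fkLaw_real_mono_weights` — **monotonicity in the weighting** (Grimmett 2006, (3.22), tree
  `rcMeasureW_real_mono_weights`): `W ≤ W'` on the pairs inside `Λ` and `q ≥ 1` give `fkLaw Λ W q (A) ≤ fkLaw Λ W' q (A)`
  for every increasing measurable `A`; with `fkLaw_real_anti_weights_of_isLowerSet` for decreasing events;
* `fkLaw_eq_of_subset` — **Λ-INDEPENDENCE**: if `W` is supported on the pairs inside `Λ` (`FinSupp W Λ`) and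
  `Λ ⊆ Λ'`, then `fkLaw Λ' W q = fkLaw Λ W q` (`0 < q`): the idle vertices of `Λ' ∖ Λ` do not matter
  (`rcMeasureW_map_image_sym2Map`, `KNFreePinningEmbedding.lean`, along `finsetInclEmb`); hence
  `fkLaw_eq_of_finSupp_of_finSupp` for two pieces both containing the support;
* `fkLaw_real_inter_setOf_subset_eq` — **pairs of weight one are open almost surely**: if `W = 1` on a set `K` of
  lattice pairs inside `Λ`, then `fkLaw Λ W q (A ∩ {K ⊆ ω}) = fkLaw Λ W q (A)` (the revealed-open / wired edges of
  the transplant's weightings, e.g. `U₀` in (32): KN p. 28 "positively correlated with the event that all edges of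
  `Q_{(0,0)}` are open" becomes an almost-sure statement under the pinned law).

## References

* G. Grimmett, *The Random-Cluster Model*, Springer 2006: §1.4 eq. (1.20) (p. 15); Thm. (3.21), eq. (3.22);
  Lemma (4.13) (p. 71). [Grimmett2006]
* G. Kozma, S. Nitzan, arXiv:2401.12397 (2024), §4 p. 24 ("in the subgraph `A`"), p. 28 ((32)). [KozmaNitzan2024]
-/

noncomputable section

open MeasureTheory Finset SimpleGraph
open scoped ENNReal Classical

namespace Summit.CriticalPhenomena.PercolationContinuityZ3.Theorems.FK

open Literature.Probability.Percolation Literature.Probability.LatticeModels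
open Literature.Probability.Percolation.KozmaNitzan

variable {d : ℕ}

/-! ### The law and its pull-back to the finite piece -/

section Basic

/-- The weighting read on the pairs of the finite piece `Λ` (the parameters of the `rcMeasureW` behind `fkLaw`).
[cite: Grimmett2006, §1.4 eq. (1.20) (p. 15)] -/
theorem fkLaw_def (Λ : Finset (Site d)) (W : Sym2 (Site d) → unitInterval) (q : ℝ) :
    fkLaw Λ W q = (rcMeasureW (fun e : Sym2 ↥Λ => W (Sym2.map Subtype.val e)) q (∅ : Set ↥Λ)).map (liftEdges Λ) :=
  rfl

/-- For `0 < q` the transplant's law is a probability measure. [cite: Grimmett2006, §1.4 eq. (1.20) (p. 15)] -/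
theorem isProbabilityMeasure_fkLaw (Λ : Finset (Site d)) (W : Sym2 (Site d) → unitInterval) {q : ℝ} (hq : 0 < q) :
    IsProbabilityMeasure (fkLaw Λ W q) := by
  haveI := isProbabilityMeasure_rcMeasureW (fun e : Sym2 ↥Λ => W (Sym2.map Subtype.val e)) hq (∅ : Set ↥Λ)
  exact Measure.isProbabilityMeasure_map (measurable_liftEdges Λ).aemeasurable

/-- **The law read on the finite piece**: `fkLaw Λ W q (A) = φ^∅_{W∘Λ,q}(liftEdges Λ ⁻¹ A)` for measurable `A`.
[cite: Grimmett2006, §1.4 eq. (1.20) (p. 15)] -/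
theorem fkLaw_apply (Λ : Finset (Site d)) (W : Sym2 (Site d) → unitInterval) (q : ℝ) {A : Set (BondConfig (Site d))}
    (hA : MeasurableSet A) :
    fkLaw Λ W q A = rcMeasureW (fun e : Sym2 ↥Λ => W (Sym2.map Subtype.val e)) q (∅ : Set ↥Λ) (liftEdges Λ ⁻¹' A) := by
  rw [fkLaw_def, Measure.map_apply (measurable_liftEdges Λ) hA]

/-- Real-valued form of `fkLaw_apply`. [cite: Grimmett2006, §1.4 eq. (1.20) (p. 15)] -/
theorem fkLaw_real_apply (Λ : Finset (Site d)) (W : Sym2 (Site d) → unitInterval) (q : ℝ)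
    {A : Set (BondConfig (Site d))} (hA : MeasurableSet A) :
    (fkLaw Λ W q).real A =
      (rcMeasureW (fun e : Sym2 ↥Λ => W (Sym2.map Subtype.val e)) q (∅ : Set ↥Λ)).real (liftEdges Λ ⁻¹' A) := by
  rw [measureReal_def, measureReal_def, fkLaw_apply Λ W q hA]

end Basic

/-! ### Monotonicity in the weighting -/

section Mono

/-- **Monotonicity of the transplant's law in the weighting** (Grimmett 2006, Thm. (3.21)/(3.22) edge by edge):
for `q ≥ 1`, if `W ≤ W'` on the pairs INSIDE `Λ` then `fkLaw Λ W q (A) ≤ fkLaw Λ W' q (A)` for every increasing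
measurable `A` — more open / less deleted environment only helps increasing events.
[cite: Grimmett2006, Thm. (3.21), eq. (3.22)] -/
theorem fkLaw_real_mono_weights (Λ : Finset (Site d)) {W W' : Sym2 (Site d) → unitInterval}
    (hWW : ∀ x ∈ Λ, ∀ y ∈ Λ, W s(x, y) ≤ W' s(x, y)) {q : ℝ} (hq : 1 ≤ q) {A : Set (BondConfig (Site d))}
    (hA : IsUpperSet A) (hAm : MeasurableSet A) :
    (fkLaw Λ W q).real A ≤ (fkLaw Λ W' q).real A := by
  rw [fkLaw_real_apply Λ W q hAm, fkLaw_real_apply Λ W' q hAm]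
  refine rcMeasureW_real_mono_weights (fun e => ?_) hq ∅ (isUpperSet_preimage_liftEdges Λ hA)
  induction e using Sym2.ind with
  | h a b => exact hWW a.1 a.2 b.1 b.2

/-- Monotonicity in the weighting, pointwise-hypothesis form. [cite: Grimmett2006, Thm. (3.21), eq. (3.22)] -/
theorem fkLaw_real_mono_weights' (Λ : Finset (Site d)) {W W' : Sym2 (Site d) → unitInterval} (hWW : W ≤ W')
    {q : ℝ} (hq : 1 ≤ q) {A : Set (BondConfig (Site d))} (hA : IsUpperSet A) (hAm : MeasurableSet A) :
    (fkLaw Λ W q).real A ≤ (fkLaw Λ W' q).real A :=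
  fkLaw_real_mono_weights Λ (fun _ _ _ _ => hWW _) hq hA hAm

/-- Monotonicity in the weighting for decreasing events: `W ≤ W'` inside `Λ`, `q ≥ 1`, `D` decreasing measurable
give `fkLaw Λ W' q (D) ≤ fkLaw Λ W q (D)`. [cite: Grimmett2006, Thm. (3.21), eq. (3.22)] -/
theorem fkLaw_real_anti_weights_of_isLowerSet (Λ : Finset (Site d)) {W W' : Sym2 (Site d) → unitInterval}
    (hWW : ∀ x ∈ Λ, ∀ y ∈ Λ, W s(x, y) ≤ W' s(x, y)) {q : ℝ} (hq : 1 ≤ q) {D : Set (BondConfig (Site d))}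
    (hD : IsLowerSet D) (hDm : MeasurableSet D) :
    (fkLaw Λ W' q).real D ≤ (fkLaw Λ W q).real D := by
  have hq0 : 0 < q := one_pos.trans_le hq
  haveI := isProbabilityMeasure_fkLaw Λ W hq0
  haveI := isProbabilityMeasure_fkLaw Λ W' hq0
  have h := fkLaw_real_mono_weights Λ hWW hq hD.compl hDm.compl
  rw [probReal_compl_eq_one_sub hDm, probReal_compl_eq_one_sub hDm] at h
  linarith

end Mono

/-! ### Λ-independence -/

section Support

/-- The inclusion of finite pieces composed with the vertex inclusion is the vertex inclusion. [folklore] -/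
theorem val_comp_finsetInclEmb {Λ Λ' : Finset (Site d)} (h : Λ ⊆ Λ') :
    (Subtype.val : ↥Λ' → Site d) ∘ finsetInclEmb h = Subtype.val := by
  funext x; rfl

/-- Lifting through a larger piece: `liftEdges Λ' (j ω) = liftEdges Λ ω` for the inclusion `j : ↥Λ ↪ ↥Λ'`. [folklore] -/
theorem liftEdges_image_finsetInclEmb {Λ Λ' : Finset (Site d)} (h : Λ ⊆ Λ') (ω : BondConfig ↥Λ) :
    liftEdges Λ' (Sym2.map (finsetInclEmb h) '' ω) = liftEdges Λ ω := by
  rw [liftEdges, liftEdges, Set.image_image]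
  refine Set.image_congr' fun z => ?_
  rw [Sym2.map_map, val_comp_finsetInclEmb h]

/-- A weighting supported on the pairs inside `Λ` vanishes, read on `Λ' ⊇ Λ`, off the range of the inclusion of
pairs. [folklore] -/
theorem weights_eq_zero_off_range {Λ Λ' : Finset (Site d)} (h : Λ ⊆ Λ') {W : Sym2 (Site d) → unitInterval}
    (hW : FinSupp W Λ) (e : Sym2 ↥Λ') (he : e ∉ Set.range (Sym2.map (finsetInclEmb h))) :
    W (Sym2.map Subtype.val e) = 0 := by
  induction e using Sym2.ind with
  | h x y =>
    apply hW.zero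
    by_contra hcon
    push Not at hcon
    have hx : (x : Site d) ∈ Λ := hcon x (by simp)
    have hy : (y : Site d) ∈ Λ := hcon y (by simp)
    exact he ⟨s(⟨x, hx⟩, ⟨y, hy⟩), by rw [Sym2.map_mk]; rfl⟩

/-- **Λ-independence of the transplant's law**: a weighting supported on the pairs inside `Λ` (`FinSupp W Λ`) has
the same law read on every larger piece `Λ' ⊇ Λ`: `fkLaw Λ' W q = fkLaw Λ W q` (`0 < q`). The extra vertices are
idle — all their pairs have parameter `0` — and add isolated clusters whose factor `q^{#idle}` cancels
(`rcMeasureW_map_image_sym2Map` along `finsetInclEmb`). [cite: Grimmett2006, Lemma (4.13) (p. 71); §1.4 eq. (1.20)] -/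
theorem fkLaw_eq_of_subset {Λ Λ' : Finset (Site d)} (h : Λ ⊆ Λ') {W : Sym2 (Site d) → unitInterval}
    (hW : FinSupp W Λ) {q : ℝ} (hq : 0 < q) : fkLaw Λ' W q = fkLaw Λ W q := by
  set j : ↥Λ ↪ ↥Λ' := finsetInclEmb h with hj
  set w' : Sym2 ↥Λ' → unitInterval := fun e => W (Sym2.map Subtype.val e) with hw'
  have hw'0 : ∀ e : Sym2 ↥Λ', e ∉ Set.range (Sym2.map j) → w' e = 0 := fun e he =>
    weights_eq_zero_off_range h hW e he
  have hemb := rcMeasureW_map_image_sym2Map j w' hw'0 hq (∅ : Set ↥Λ)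
  rw [Set.image_empty] at hemb
  have hcomp : (fun e : Sym2 ↥Λ => w' (Sym2.map j e)) = fun e : Sym2 ↥Λ => W (Sym2.map Subtype.val e) := by
    funext e
    simp only [hw', Sym2.map_map, hj, val_comp_finsetInclEmb h]
  rw [fkLaw_def Λ', fkLaw_def Λ, ← hemb, hcomp,
    Measure.map_map (measurable_liftEdges Λ') (Measurable.of_discrete), ]
  congr 1
  funext ω
  exact liftEdges_image_finsetInclEmb h ω

/-- Λ-independence, symmetric form: two pieces both containing the support of `W` give the same law (`0 < q`).
[cite: Grimmett2006, Lemma (4.13) (p. 71); §1.4 eq. (1.20)] -/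
theorem fkLaw_eq_of_finSupp_of_subset {Λ₀ Λ Λ' : Finset (Site d)} (h : Λ₀ ⊆ Λ) (h' : Λ₀ ⊆ Λ')
    {W : Sym2 (Site d) → unitInterval} (hW : FinSupp W Λ₀) {q : ℝ} (hq : 0 < q) : fkLaw Λ W q = fkLaw Λ' W q := by
  rw [fkLaw_eq_of_subset h hW hq, fkLaw_eq_of_subset h' hW hq]

/-- A restricted weighting is supported on the restricting set. [cite: KozmaNitzan2024, §4 p. 24 (the subgraph A)] -/
theorem finSupp_restrW (S : Finset (Site d)) (W : Sym2 (Site d) → unitInterval) :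
    FinSupp (restrW (↑S : Set (Site d)) W) S := by
  refine ⟨fun e he => restrW_apply_of_not_mem _ fun hw => ?_⟩
  obtain ⟨x, hx, hxS⟩ := he
  exact hxS (Finset.mem_coe.1 (hw.1 x hx))

end Support

/-! ### Pairs of weight one are open almost surely -/

section WeightOne

variable {V : Type*} [Fintype V]

/-- Under `φ^B_{w,q}` a configuration missing a pair of parameter `1` has weight `0`. [cite: Grimmett2006, §1.4 eq. (1.20) (p. 15)] -/
theorem rcWeightW_eq_zero_of_not_mem_of_eq_one (w : Sym2 V → unitInterval) (q : ℝ) (B : Set V) {e : Sym2 V}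
    (he : w e = 1) {ω : BondConfig V} (hω : e ∉ ω) : rcWeightW w q B ω = 0 := by
  unfold rcWeightW BHK2006.weight
  rw [Finset.prod_eq_zero (Finset.mem_univ e) (by rw [if_neg hω]; simp [he]), zero_mul]

/-- **Pairs of parameter one are open almost surely** under `φ^B_{w,q}` (`0 < q`): for a set `K` of pairs with `w = 1`
on `K`, `φ(A ∩ {K ⊆ ω}) = φ(A)`. [cite: Grimmett2006, §1.4 eq. (1.20) (p. 15)] -/
theorem rcMeasureW_real_inter_setOf_subset_eq (w : Sym2 V → unitInterval) {q : ℝ} (hq : 0 < q) (B : Set V)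
    {K : Set (Sym2 V)} (hK : ∀ e ∈ K, w e = 1) (A : Set (BondConfig V)) :
    (rcMeasureW w q B).real (A ∩ {ω | K ⊆ ω}) = (rcMeasureW w q B).real A := by
  rw [rcMeasureW_real_eq_sum_div w hq, rcMeasureW_real_eq_sum_div w hq]
  congr 1
  refine Finset.sum_congr rfl fun ω _ => ?_
  by_cases hKω : K ⊆ ω
  · have : ω ∈ A ∩ {ω | K ⊆ ω} ↔ ω ∈ A := ⟨fun h => h.1, fun h => ⟨h, hKω⟩⟩
    by_cases hA : ω ∈ A
    · rw [DecisionTree.ind_of_mem hA, DecisionTree.ind_of_mem (this.2 hA)]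
    · rw [DecisionTree.ind_of_not_mem hA, DecisionTree.ind_of_not_mem (fun h => hA (this.1 h))]
  · obtain ⟨e, heK, heω⟩ := Set.not_subset.1 hKω
    rw [rcWeightW_eq_zero_of_not_mem_of_eq_one w q B (hK e heK) heω, zero_mul, zero_mul]

/-- The event "every pair of `K` is open" is a countable intersection of coordinate events. [folklore] -/
theorem setOf_subset_eq_biInter {ι : Type*} (K : Set ι) : {ω : Set ι | K ⊆ ω} = ⋂ e ∈ K, {ω | e ∈ ω} := by
  ext ω
  simp only [Set.mem_setOf_eq, Set.mem_iInter]
  exact Iff.rfl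

/-- The event "every pair of the countable set `K` is open" is measurable. [folklore] -/
theorem measurableSet_setOf_setSubset {ι : Type*} {K : Set ι} (hK : K.Countable) :
    MeasurableSet {ω : Set ι | K ⊆ ω} := by
  rw [setOf_subset_eq_biInter]
  exact MeasurableSet.biInter hK fun e _ => measurableSet_mem e

/-- Pulling "every pair of `K` is open" back along the lift: for `K` a set of pairs inside `Λ` it is "every pair of
`Λ` over `K` is open". [folklore] -/
theorem liftEdges_preimage_setOf_setSubset (Λ : Finset (Site d)) {K : Set (Sym2 (Site d))}
    (hKΛ : ∀ e ∈ K, ∀ x ∈ e, x ∈ Λ) :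
    liftEdges Λ ⁻¹' {ω : BondConfig (Site d) | K ⊆ ω} =
      {ω : BondConfig ↥Λ | {e : Sym2 ↥Λ | Sym2.map Subtype.val e ∈ K} ⊆ ω} := by
  ext ω
  simp only [Set.mem_preimage, Set.mem_setOf_eq]
  constructor
  · intro h e he
    obtain ⟨e', he', hee'⟩ := (mem_liftEdges_iff).1 (h he)
    rwa [← (Sym2.map.injective Subtype.val_injective) hee']
  · intro h z hz
    induction z using Sym2.ind with
    | h x y =>
      have hx : x ∈ Λ := hKΛ _ hz x (Sym2.mem_mk_left x y)
      have hy : y ∈ Λ := hKΛ _ hz y (Sym2.mem_mk_right x y)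
      have hz' : s((⟨x, hx⟩ : ↥Λ), ⟨y, hy⟩) ∈ {e : Sym2 ↥Λ | Sym2.map Subtype.val e ∈ K} := by
        show Sym2.map Subtype.val s((⟨x, hx⟩ : ↥Λ), ⟨y, hy⟩) ∈ K
        rw [Sym2.map_mk]; exact hz
      exact (mem_liftEdges_iff).2 ⟨_, h hz', by rw [Sym2.map_mk]⟩

/-- **Pairs of weight one are open almost surely under the transplant's law**: if `W = 1` on a countable set `K` of
pairs INSIDE `Λ`, then `fkLaw Λ W q (A ∩ {K ⊆ ω}) = fkLaw Λ W q (A)` for every measurable `A` (`0 < q`) — e.g. the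
wired cube `U₀` of (32), or the revealed-open edges of a history. [cite: KozmaNitzan2024, §4 p. 28 ((32)); Grimmett2006, Thm. (3.7)] -/
theorem fkLaw_real_inter_setOf_subset_eq (Λ : Finset (Site d)) {W : Sym2 (Site d) → unitInterval} {q : ℝ}
    (hq : 0 < q) {K : Set (Sym2 (Site d))} (hKc : K.Countable) (hKΛ : ∀ e ∈ K, ∀ x ∈ e, x ∈ Λ)
    (hK : ∀ e ∈ K, W e = 1) {A : Set (BondConfig (Site d))} (hA : MeasurableSet A) :
    (fkLaw Λ W q).real (A ∩ {ω | K ⊆ ω}) = (fkLaw Λ W q).real A := by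
  rw [fkLaw_real_apply Λ W q (hA.inter (measurableSet_setOf_setSubset hKc)), fkLaw_real_apply Λ W q hA,
    Set.preimage_inter, liftEdges_preimage_setOf_setSubset Λ hKΛ]
  exact rcMeasureW_real_inter_setOf_subset_eq (fun e : Sym2 ↥Λ => W (Sym2.map Subtype.val e)) hq (∅ : Set ↥Λ)
    (K := {e : Sym2 ↥Λ | Sym2.map Subtype.val e ∈ K}) (fun e he => hK (Sym2.map Subtype.val e) he)
    (liftEdges Λ ⁻¹' A)

end WeightOne

end Summit.CriticalPhenomena.PercolationContinuityZ3.Theorems.FK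

end
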